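import Summits.BirchSwinnertonDyer.BirchSwinnertonDyer.Theses.ResidualThetaTransportAtTwo
import Literature.NumberTheory.EllipticCurves.Kato2004.IwasawaCohomologyCoeffExistsProofs
import HarnessLib

/-!
# RTT item K0a `KatoIwasawaH1DataCoeffNewformInput` (stmt-BirchSwinnertonDyer-24114) — CLOSED by the tree
# theorem `Kato2004.nonempty_iwasawaH1DataCoeff_newform_holds`

Route `ResidualThetaTransportAtTwo` (RTT), aside item r9 `KatoIwasawaH1DataCoeffNewformInput`
(stmt-BirchSwinnertonDyer-24114): the route-level alias of the Literature named fact
`Literature.NumberTheory.EllipticCurves.Kato2004.nonempty_iwasawaH1DataCoeff_newform` (Kato 2004, Astérisque 295,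
§12.2 (12.2.1) with §13.8: the pinned Iwasawa cohomology `𝐇¹_Γ(T_ρ)` over `𝒪⟦X⟧` EXISTS for the lattice of an
integral `p`-adic model `ρ` of a weight-`2` newform with `𝒪_λ`-coefficients, every prime `p`), filed by the pen
as a HOLD input alias («cleared if the fact is ever discharged»).  The fact IS now discharged:
`Kato2004.nonempty_iwasawaH1DataCoeff_newform_holds` (`Literature/…/Kato2004/IwasawaCohomologyCoeffExistsProofs.lean`,
seat `bsd-wall-tp2-p2x` g20, p722694) constructs the datum over any `I`-adically complete coefficient ring with
`p ∈ I` (Weierstrass division by the distinguished `ω_n = (X+1)^{p^n} − 1`), in particular over the complete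
discrete valuation ring `𝒪 = padicCoeffIntegers (Set.range ι)`.  This file closes the item BY NAME.

THEOREMS ONLY (one theorem; no definition, no named fact, no instance, no `sorry`).  HONEST FRAMING: K0a is a
CONSTRUCTION fact with no arithmetic content; its discharge removes one print leaf of the RTT cone (the conjunct
`nonempty_iwasawaH1DataCoeff_newform` of the registered stub `stub_kzgPrints` of crux RSL_g
stmt-BirchSwinnertonDyer-22608 is now a theorem); Kato's Thm. 12.4 (2) (K0b, item 24115) is untouched; BSD is
not proved by any of this; RSL_g 22608 stays OPEN.

References: [Kato2004Asterisque] §12.2 (12.2.1) p. 220, §13.8 p. 228; [Lang1990] Ch. 5 §1 Thm. 1.1;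
[Washington1997] Thm. 7.1, Prop. 7.2.
-/

set_option autoImplicit false
-- the Theorems namespace of this sub repeats the summit name by design (D-0017 nested layout)
set_option linter.dupNamespace false

namespace Summit.BirchSwinnertonDyer.BirchSwinnertonDyer.Theorems

/-- **RTT item K0a `KatoIwasawaH1DataCoeffNewformInput` holds**: it is, by definition, the Literature named fact
`Kato2004.nonempty_iwasawaH1DataCoeff_newform`, discharged by the tree theorem
`Kato2004.nonempty_iwasawaH1DataCoeff_newform_holds` (Kato 2004 §12.2 (12.2.1) / §13.8: existence of the pinned
`𝐇¹_Γ(T_ρ)` over `𝒪⟦X⟧`, by Weierstrass division over the complete coefficient ring `𝒪`).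
[cite: Kato2004Asterisque, §12.2 (12.2.1) (p. 220) and §13.8 (p. 228)] [cite: Lang1990, Ch. 5 §1 Thm. 1.1] -/
theorem katoIwasawaH1DataCoeffNewformInput_proof :
    Summit.BirchSwinnertonDyer.BirchSwinnertonDyer.Theses.ResidualThetaTransportAtTwo.KatoIwasawaH1DataCoeffNewformInput := by
  unfold Summit.BirchSwinnertonDyer.BirchSwinnertonDyer.Theses.ResidualThetaTransportAtTwo.KatoIwasawaH1DataCoeffNewformInput
  exact Literature.NumberTheory.EllipticCurves.Kato2004.nonempty_iwasawaH1DataCoeff_newform_holds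

end Summit.BirchSwinnertonDyer.BirchSwinnertonDyer.Theorems
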